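import Literature.MathematicalPhysics.QuantumFieldTheory.Balaban1983to89.Node00.TwoRunSitePersistence

/-!
# NODE 00 — THE LEVEL WINDOW ON THE TWO-RUN SITE KEY (node U5d ∕ the KEY-READING dial of K3⁷'s stub 2): «no structure older than the floor
# `c` is keyed» — the entries of BOTH sequences of a key at the levels `1 ≤ j ≤ c` replaced by the whole lattice; the fibres of this coarsening
# (indices agreeing ABOVE the floor), its algebra, and what it does to the persistence predicate `KeyOldLargeField` of `Node00/TwoRunSitePersistence`

Cell `pub-ymgap`, YM-PLAN Track A (HUMAN RULING D-0062; width push D-0149); seat `pub-ymgap-dag-n20-d` (R134 (a) N20 NE7b s3) gen 29 (v1.1: header quotation corrected, decls byte-identical; v1.2: §5 `largeFieldVolume` APPENDED, earlier decls byte-identical) — continuation of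
`Node00/TwoRunSite{Transport,Key,Lift,Persistence}` (p561554 ∕ p570161 ∕ p575738 ∕ p583644).  Filed on the crux card `window-key-core` (K3⁷
`SpineGivenEndpointR13SepCoPH`, stmt-QuantumFields-20544; `Cruxes/SpineGivenEndpointR13SepCoPH/Ideas/window-key-core.md`, idea-3 g8; CRIT-1 triage
`…/CRIT-1-TRIAGE-window-key-core.md` (1) «the proposed key-reading dial gets a VALUE») and dag-n19-w1's located reading `…/N19W1-STUB2-N19PRIME-READING.md` §2
(«a key-reading dial `kr` beside `jc`∕`sh`»).  [III] = [Balaban1988Convergent], [LF-I] = [Balaban1989LargeFieldI], [LF-II] = [Balaban1989LargeFieldII].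

WHY.  The K5 faces of the spine (N19′ core edge, N20 relative weight, N21 shells) are read at dag-n20-d's reading of record `crOfRecord₁₃V`, whose classes are keyed by
the σ-packed FULL (2.18) histories `(Ω_1, …, Ω_K; Λ_1, …, Λ_K)` ([III] (2.18) p.257) through node U5d's coupling-free keys `twoRunKeyA ∕ twoRunKeyB` (`Node00/TwoRunSiteKey`).
Print keeps old structure in the description only for a WINDOW of steps: [III] p.244 l.29–31, on the large-field factor in `d = 4`, «It is still small for ε small, and it controls
a large number of steps, but this number is a small fraction of the total number of steps.» (verbatim; the same passage opens [LF-I] p.175 — v1.1: this sentence replaces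
v1.0's paraphrase, which ref-K READ-249 NIT-L1 rightly flagged as not on the page); [LF-II] p.384 (1.80) «The factor exp(−κ_j(Z)) controls K renormalization steps … where the number K is the smallest positive integer having the property that
the domain S^K(Z) … satisfies the conditions (i), (ii), with N = R_j» — after which the 𝐑-operation resums the region and its history leaves the index.  The crux card
proposes to read N19′ ∧ N20 at a COARSER key than the full history.  This file types the simplest such coarsening that lives on the key itself — the LEVEL WINDOW with
floor `c`: forget every entry at the levels `1 ≤ j ≤ c` (declare them «whole lattice», i.e. no large field and no restriction kept), keep the levels `j > c` — together
with its algebra, its fibres («two indices have the same window key iff they agree above the floor»), and its interplay with the persistence predicate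
[the items below continue after this ERRATUM (v1.2, dag-n20-w2 g3 LOCATED, pub-ymgap INBOX l.31349, concurred l.31377): the level window forgets the index ENTRIES at the
levels `≤ c`, NOT the STRUCTURE born there — the (2.1) chain is cumulative (`Chain21.Λ_subset ∕ Ω_succ_subset`), so a large-field region born at level `1` is a hole
of `Λ_j` at EVERY kept level and two histories differing by an old birth keep DISTINCT window keys (`windowKey_eq_windowKey_iff`); v1.0's phrase «the old history
summed, the recent history keyed» (docstring of `windowKey_seqKey_eq_iff`) over-reads the object: what is summed over a window fibre are the histories with THE SAME
entries above the floor, old holes included.  The coarsening that forgives old structure together with its growth is component-wise — `Node00/TwoRunSiteComponents`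
(`forgiveKeyComp`); the level window is the floor-erasure both share (`windowKey_forgiveKeyComp`)]
`KeyOldLargeField jcut` of `Node00/TwoRunSitePersistence` («an old large-field region at a level `≤ jcut`»): a level cut AT OR BELOW the floor books nothing at the window key,
a level cut above the floor sees exactly the old regions between the floor and the cut.  The σ-packed form `windowKeySigma` (a floor per step `K`) is the VALUE a key-reading
dial on `Σ K, SiteSeqKey F (K₀ + K)` takes in the window road (card § «What it needs» K3∕D1 in its key-level form: the card's per-step window LENGTH `j⋆(K)` is the floor
`c K = (K₀ + K) − j⋆(K)`).
HONEST — WHAT THIS IS NOT.  This is NOT Bałaban's region-relative pending window `K(Z)` of (1.80): that number depends on the component `Z` (through the iterated operation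
`S` of p.384 and the conditions (i), (ii) of [LF-I] p.177), and condition (ii) («in the preceding N renormalization steps no new large field regions were created inside this
component») is an event of the expansion, not a function of one key — the cell `pub-balaban` types it in the ℤᵈ index model with the cleanliness clause as a PARAMETER
(`B16StoppingRule.CondI ∕ CondII ∕ StopAt`, `B16SProfile.Siter`).  The level window is the key-level SHADOW of that bookkeeping (one floor per step, uniform over regions);
a region-relative coarsening would be a further quotient of the same key space and is left open.  No weight, no estimate, no choice of the floor; NE7 ∕ NE7b ∕ NE7c are NOT
PRINTED for `d = 4` and NOT proved; nothing of Bałaban's is asserted; no node count moves (typed 28∕28 · discharged 5∕27); no `sorry`, no `axiom`, no `instance`, no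
`notation`; one finite four-torus programme at fixed `ε` — NOT ℝ⁴, NOT OS, NOT a mass gap, NOT the Clay problem.
-/

noncomputable section

open scoped BigOperators

namespace Literature.MathematicalPhysics.QuantumFieldTheory.Balaban1983to89.Node00

open T4Continuum B14.Eq213MaximalDomains B15Eq112TorusCover B14DomainGeom B14.Eq218Concrete

/-! ## §1  The level window on a key: definition and algebra -/

section Window

variable {α : Type*}

/-- **THE LEVEL WINDOW WITH FLOOR `c`** on a key `x = (Ω, Λ)`: the entries of both sequences at the levels `1 ≤ j ≤ c` are replaced by the whole lattice («nothing older
than the floor is keyed»), the entries at the levels `j > c` (and the conventional level `0`) are kept.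
[cite: Balaban1989LargeFieldII, (1.80) p.384 (bookkeeping); Balaban1988Convergent, p.244 (bookkeeping)] -/
def windowKey (c : ℕ) (x : (ℕ → Set α) × (ℕ → Set α)) : (ℕ → Set α) × (ℕ → Set α) :=
  (fun j => if 1 ≤ j ∧ j ≤ c then Set.univ else x.1 j, fun j => if 1 ≤ j ∧ j ≤ c then Set.univ else x.2 j)

/-- First sequence of the window key, unfolded. [cite: Balaban1989LargeFieldII, (1.80) p.384 (bookkeeping)] -/
theorem windowKey_fst (c : ℕ) (x : (ℕ → Set α) × (ℕ → Set α)) (j : ℕ) :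
    (windowKey c x).1 j = if 1 ≤ j ∧ j ≤ c then Set.univ else x.1 j := rfl

/-- Second sequence of the window key, unfolded. [cite: Balaban1989LargeFieldII, (1.80) p.384 (bookkeeping)] -/
theorem windowKey_snd (c : ℕ) (x : (ℕ → Set α) × (ℕ → Set α)) (j : ℕ) :
    (windowKey c x).2 j = if 1 ≤ j ∧ j ≤ c then Set.univ else x.2 j := rfl

/-- AT OR BELOW THE FLOOR the window key keeps nothing: the first entry is the whole lattice. [cite: Balaban1989LargeFieldII, (1.80) p.384 (bookkeeping)] -/
theorem windowKey_fst_of_le (c : ℕ) (x : (ℕ → Set α) × (ℕ → Set α)) {j : ℕ} (h1 : 1 ≤ j) (hj : j ≤ c) :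
    (windowKey c x).1 j = Set.univ :=
  if_pos ⟨h1, hj⟩

/-- AT OR BELOW THE FLOOR the window key keeps nothing: the second entry is the whole lattice («no large field kept»).
[cite: Balaban1989LargeFieldII, (1.80) p.384 (bookkeeping)] -/
theorem windowKey_snd_of_le (c : ℕ) (x : (ℕ → Set α) × (ℕ → Set α)) {j : ℕ} (h1 : 1 ≤ j) (hj : j ≤ c) :
    (windowKey c x).2 j = Set.univ :=
  if_pos ⟨h1, hj⟩

/-- ABOVE THE FLOOR the window key is the key: first entry. [cite: Balaban1989LargeFieldII, (1.80) p.384 (bookkeeping)] -/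
theorem windowKey_fst_of_lt (c : ℕ) (x : (ℕ → Set α) × (ℕ → Set α)) {j : ℕ} (hj : c < j) : (windowKey c x).1 j = x.1 j :=
  if_neg fun h => absurd h.2 (not_le.mpr hj)

/-- ABOVE THE FLOOR the window key is the key: second entry. [cite: Balaban1989LargeFieldII, (1.80) p.384 (bookkeeping)] -/
theorem windowKey_snd_of_lt (c : ℕ) (x : (ℕ → Set α) × (ℕ → Set α)) {j : ℕ} (hj : c < j) : (windowKey c x).2 j = x.2 j :=
  if_neg fun h => absurd h.2 (not_le.mpr hj)

/-- The conventional level `0` is untouched (first entry). [cite: Balaban1988Convergent, (2.18) p.257 (bookkeeping)] -/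
theorem windowKey_fst_zero_level (c : ℕ) (x : (ℕ → Set α) × (ℕ → Set α)) : (windowKey c x).1 0 = x.1 0 := by
  rw [windowKey_fst, if_neg]
  exact fun h => absurd h.1 (by decide)

/-- The conventional level `0` is untouched (second entry). [cite: Balaban1988Convergent, (2.18) p.257 (bookkeeping)] -/
theorem windowKey_snd_zero_level (c : ℕ) (x : (ℕ → Set α) × (ℕ → Set α)) : (windowKey c x).2 0 = x.2 0 := by
  rw [windowKey_snd, if_neg]
  exact fun h => absurd h.1 (by decide)

/-- **FLOOR `0` IS THE FULL KEY**: `windowKey 0 = id` (the record's pinned key is the window key with nothing forgotten).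
[cite: Balaban1988Convergent, (2.18) p.257 (bookkeeping)] -/
theorem windowKey_zero (x : (ℕ → Set α) × (ℕ → Set α)) : windowKey 0 x = x :=
  Prod.ext (funext fun _ => if_neg fun h => absurd (h.1.trans h.2) (by decide)) (funext fun _ => if_neg fun h => absurd (h.1.trans h.2) (by decide))

/-- Raising the floor after a lower window is the higher window. [cite: Balaban1989LargeFieldII, (1.80) p.384 (bookkeeping)] -/
theorem windowKey_windowKey_of_le {c c' : ℕ} (h : c ≤ c') (x : (ℕ → Set α) × (ℕ → Set α)) : windowKey c' (windowKey c x) = windowKey c' x := by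
  refine Prod.ext (funext fun j => ?_) (funext fun j => ?_)
  · by_cases hj : 1 ≤ j ∧ j ≤ c'
    · rw [windowKey_fst_of_le c' _ hj.1 hj.2, windowKey_fst_of_le c' _ hj.1 hj.2]
    · have hj' : ¬ (1 ≤ j ∧ j ≤ c) := fun h' => hj ⟨h'.1, h'.2.trans h⟩
      rw [windowKey_fst c' (windowKey c x) j, if_neg hj, windowKey_fst c x j, if_neg hj', windowKey_fst c' x j, if_neg hj]
  · by_cases hj : 1 ≤ j ∧ j ≤ c'
    · rw [windowKey_snd_of_le c' _ hj.1 hj.2, windowKey_snd_of_le c' _ hj.1 hj.2]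
    · have hj' : ¬ (1 ≤ j ∧ j ≤ c) := fun h' => hj ⟨h'.1, h'.2.trans h⟩
      rw [windowKey_snd c' (windowKey c x) j, if_neg hj, windowKey_snd c x j, if_neg hj', windowKey_snd c' x j, if_neg hj]

/-- A lower window after a higher one changes nothing. [cite: Balaban1989LargeFieldII, (1.80) p.384 (bookkeeping)] -/
theorem windowKey_windowKey_of_ge {c c' : ℕ} (h : c' ≤ c) (x : (ℕ → Set α) × (ℕ → Set α)) : windowKey c' (windowKey c x) = windowKey c x := by
  refine Prod.ext (funext fun j => ?_) (funext fun j => ?_)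
  · by_cases hj : 1 ≤ j ∧ j ≤ c'
    · rw [windowKey_fst_of_le c' _ hj.1 hj.2, windowKey_fst_of_le c _ hj.1 (hj.2.trans h)]
    · rw [windowKey_fst c' (windowKey c x) j, if_neg hj]
  · by_cases hj : 1 ≤ j ∧ j ≤ c'
    · rw [windowKey_snd_of_le c' _ hj.1 hj.2, windowKey_snd_of_le c _ hj.1 (hj.2.trans h)]
    · rw [windowKey_snd c' (windowKey c x) j, if_neg hj]

/-- **THE WINDOW IS IDEMPOTENT** (a coarsening). [cite: Balaban1989LargeFieldII, (1.80) p.384 (bookkeeping)] -/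
theorem windowKey_idem (c : ℕ) (x : (ℕ → Set α) × (ℕ → Set α)) : windowKey c (windowKey c x) = windowKey c x :=
  windowKey_windowKey_of_le le_rfl x

/-- Two windows compose to the window with the HIGHER floor (the windows form a monotone tower of coarsenings of the key).
[cite: Balaban1989LargeFieldII, (1.80) p.384 (bookkeeping)] -/
theorem windowKey_windowKey (c c' : ℕ) (x : (ℕ → Set α) × (ℕ → Set α)) : windowKey c' (windowKey c x) = windowKey (max c c') x := by
  rcases le_total c c' with h | h
  · rw [max_eq_right h, windowKey_windowKey_of_le h]
  · rw [max_eq_left h, windowKey_windowKey_of_ge h]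

/-- A higher window factors through a lower one: `windowKey c'` is constant on the fibres of `windowKey c` for `c ≤ c'`.
[cite: Balaban1989LargeFieldII, (1.80) p.384 (bookkeeping)] -/
theorem windowKey_eq_of_windowKey_eq {c c' : ℕ} (h : c ≤ c') {x y : (ℕ → Set α) × (ℕ → Set α)} (hxy : windowKey c x = windowKey c y) :
    windowKey c' x = windowKey c' y := by
  rw [← windowKey_windowKey_of_le h x, ← windowKey_windowKey_of_le h y, hxy]

/-- **THE FIBRES OF THE WINDOW**: two keys have the same window key iff they AGREE ABOVE THE FLOOR (and at the conventional level `0`).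
[cite: Balaban1989LargeFieldII, (1.80) p.384 (bookkeeping); Balaban1988Convergent, (2.18) p.257 (bookkeeping)] -/
theorem windowKey_eq_windowKey_iff (c : ℕ) (x y : (ℕ → Set α) × (ℕ → Set α)) :
    windowKey c x = windowKey c y ↔ ∀ j, ¬ (1 ≤ j ∧ j ≤ c) → x.1 j = y.1 j ∧ x.2 j = y.2 j := by
  constructor
  · intro h j hj
    have h₁ := congrFun (congrArg Prod.fst h) j
    have h₂ := congrFun (congrArg Prod.snd h) j
    rw [windowKey_fst c x j, windowKey_fst c y j, if_neg hj, if_neg hj] at h₁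
    rw [windowKey_snd c x j, windowKey_snd c y j, if_neg hj, if_neg hj] at h₂
    exact ⟨h₁, h₂⟩
  · intro h
    refine Prod.ext (funext fun j => ?_) (funext fun j => ?_)
    · by_cases hj : 1 ≤ j ∧ j ≤ c
      · rw [windowKey_fst_of_le c x hj.1 hj.2, windowKey_fst_of_le c y hj.1 hj.2]
      · rw [windowKey_fst c x j, windowKey_fst c y j, if_neg hj, if_neg hj]; exact (h j hj).1
    · by_cases hj : 1 ≤ j ∧ j ≤ c
      · rw [windowKey_snd_of_le c x hj.1 hj.2, windowKey_snd_of_le c y hj.1 hj.2]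
      · rw [windowKey_snd c x j, windowKey_snd c y j, if_neg hj, if_neg hj]; exact (h j hj).2

end Window

/-! ## §2  The window and the persistence predicate `KeyOldLargeField` -/

section Persistence

variable {α : Type*}

/-- ★ **A LEVEL CUT AT OR BELOW THE FLOOR BOOKS NOTHING AT THE WINDOW KEY**: for `jcut ≤ c` no window key carries an old large-field region at a level `≤ jcut` —
the levels a persistence policy below the floor would inspect have been forgotten. [cite: Balaban1989LargeFieldII, (1.80) p.384 (bookkeeping)] -/
theorem not_keyOldLargeField_windowKey {jcut c : ℕ} (h : jcut ≤ c) (x : (ℕ → Set α) × (ℕ → Set α)) : ¬ KeyOldLargeField jcut (windowKey c x) := by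
  rintro ⟨j, h1, hj, hne⟩
  exact hne (windowKey_snd_of_le c x h1 (hj.trans h))

/-- ★ **OLD REGIONS ABOVE THE FLOOR ARE KEPT**: the window key carries an old large-field region at a level `≤ jcut` iff the key carries one at a level STRICTLY ABOVE the
floor and `≤ jcut`. [cite: Balaban1989LargeFieldII, (1.80) p.384 (bookkeeping)] -/
theorem keyOldLargeField_windowKey_iff (jcut c : ℕ) (x : (ℕ → Set α) × (ℕ → Set α)) :
    KeyOldLargeField jcut (windowKey c x) ↔ ∃ j, c < j ∧ j ≤ jcut ∧ x.2 j ≠ Set.univ := by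
  constructor
  · rintro ⟨j, h1, hj, hne⟩
    by_cases hc : j ≤ c
    · exact (hne (windowKey_snd_of_le c x h1 hc)).elim
    · exact ⟨j, not_le.mp hc, hj, by rwa [windowKey_snd_of_lt c x (not_le.mp hc)] at hne⟩
  · rintro ⟨j, hcj, hj, hne⟩
    exact ⟨j, Nat.one_le_of_lt hcj, hj, by rwa [windowKey_snd_of_lt c x hcj]⟩

/-- An old region on the window key is an old region on the key (coarsening never CREATES bad keys). [cite: Balaban1989LargeFieldII, (1.80) p.384 (bookkeeping)] -/
theorem keyOldLargeField_of_windowKey {jcut c : ℕ} {x : (ℕ → Set α) × (ℕ → Set α)} (hx : KeyOldLargeField jcut (windowKey c x)) : KeyOldLargeField jcut x := by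
  obtain ⟨j, hcj, hj, hne⟩ := (keyOldLargeField_windowKey_iff jcut c x).1 hx
  exact ⟨j, Nat.one_le_of_lt hcj, hj, hne⟩

/-- With the floor at `0` the persistence predicate is unchanged. [cite: Balaban1989LargeFieldII, (1.80) p.384 (bookkeeping)] -/
theorem keyOldLargeField_windowKey_zero_iff (jcut : ℕ) (x : (ℕ → Set α) × (ℕ → Set α)) :
    KeyOldLargeField jcut (windowKey 0 x) ↔ KeyOldLargeField jcut x := by
  rw [windowKey_zero]

/-- The bad keys of a windowed class set under a policy at or below the floor: NONE. [cite: Balaban1989LargeFieldII, (1.80) p.384 (bookkeeping)] -/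
theorem badKeys_image_windowKey_eq_empty [DecidableEq ((ℕ → Set α) × (ℕ → Set α))] (T : Finset ((ℕ → Set α) × (ℕ → Set α))) {jcut c : ℕ}
    (h : jcut ≤ c) : badKeys (T.image (windowKey c)) jcut = ∅ := by
  refine Finset.eq_empty_of_forall_notMem fun x hx => ?_
  obtain ⟨hxT, hbad⟩ := (mem_badKeys_iff _ jcut x).1 hx
  obtain ⟨y, -, rfl⟩ := Finset.mem_image.mp hxT
  exact not_keyOldLargeField_windowKey h y hbad

end Persistence

/-! ## §3  The window on (2.18) indices and on node U5d's two keys -/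

section Indices

variable {α : Type*} {D : ℕ → Set (Set α)} {k : ℕ}

/-- **THE FIBRE OF THE WINDOW OVER THE FORGETFUL KEY**: two (2.18) indices have the same window key iff their sequences AGREE AT EVERY LEVEL ABOVE THE FLOOR — the keyed
class of an index family along `windowKey c ∘ seqKey` is the PARTIAL SUM over the entries at the levels `1, …, c` (the «old» history summed, the «recent» history keyed).
[cite: Balaban1988Convergent, (2.18) p.257 (bookkeeping); Balaban1989LargeFieldII, (1.80) p.384 (bookkeeping)] -/
theorem windowKey_seqKey_eq_iff (c : ℕ) (s t : Seq D k) :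
    windowKey c (seqKey s) = windowKey c (seqKey t) ↔ ∀ j, c < j → s.Ω j = t.Ω j ∧ s.Λ j = t.Λ j := by
  rw [windowKey_eq_windowKey_iff]
  simp only [seqKey_fst, seqKey_snd]
  constructor
  · intro h j hj
    exact h j fun h' => absurd h'.2 (not_le.mpr hj)
  · intro h j hj
    by_cases h0 : j = 0
    · subst h0
      rw [s.Ω_off 0 (fun h' => absurd h'.1 (by decide)), t.Ω_off 0 (fun h' => absurd h'.1 (by decide)),
        s.Λ_off 0 (fun h' => absurd h'.1 (by decide)), t.Λ_off 0 (fun h' => absurd h'.1 (by decide))]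
      exact ⟨rfl, rfl⟩
    · exact h j (not_le.mp fun hjc => hj ⟨Nat.one_le_iff_ne_zero.mpr h0, hjc⟩)

/-- With the floor at or above the index length EVERYTHING is forgotten: all indices of length `k ≤ c` have the same window key.
[cite: Balaban1988Convergent, (2.18) p.257 (bookkeeping)] -/
theorem windowKey_seqKey_eq_of_le {c : ℕ} (hk : k ≤ c) (s t : Seq D k) : windowKey c (seqKey s) = windowKey c (seqKey t) := by
  rw [windowKey_seqKey_eq_iff]
  intro j hj
  have hoff : ¬ (1 ≤ j ∧ j ≤ k) := fun h' => absurd (h'.2.trans hk) (not_le.mpr hj)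
  rw [s.Ω_off j hoff, t.Ω_off j hoff, s.Λ_off j hoff, t.Λ_off j hoff]
  exact ⟨rfl, rfl⟩

variable (F : T4Family)

/-- **RUN A AT THE WINDOW KEY**: two run-A indices have the same window key iff they agree above the floor. [cite: Balaban1988Convergent, (2.18) p.257 (bookkeeping)] -/
theorem windowKey_twoRunKeyA_eq_iff (ν : Stage7Numerics) (M : ℕ) (gA : ℕ → ℝ) (K k c : ℕ) (s t : SeqOfRecord F ν M gA K k) :
    windowKey c (twoRunKeyA F ν M gA K k s) = windowKey c (twoRunKeyA F ν M gA K k t) ↔ ∀ j, c < j → s.Ω j = t.Ω j ∧ s.Λ j = t.Λ j :=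
  windowKey_seqKey_eq_iff c s t

/-- **RUN B AT THE WINDOW KEY**: two run-B indices have the same window key iff their flow-free block-down truncations agree above the floor — i.e. iff their OWN
entries agree, after blocking down, at every level `j + 1` with `j > c` (the level-`1` entry and the levels `2, …, c + 1` summed).
[cite: Balaban1988Convergent, (2.18) p.257 (bookkeeping)] -/
theorem windowKey_twoRunKeyB_eq_iff (ν : Stage7Numerics) {M : ℕ} (hM : 0 < M) (gB : ℕ → ℝ) (K k c : ℕ) (s' t' : SeqOfRecord F ν M gB (K + 1) (k + 1)) :
    windowKey c (twoRunKeyB F ν hM gB K k s') = windowKey c (twoRunKeyB F ν hM gB K k t') ↔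
      ∀ j, c < j → (truncShift F ν hM gB s').Ω j = (truncShift F ν hM gB t').Ω j ∧ (truncShift F ν hM gB s').Λ j = (truncShift F ν hM gB t').Λ j :=
  windowKey_seqKey_eq_iff c _ _

/-- Run B above the floor and on the window, in run B's own entries: agreement of the block-downs `blockDownSet (Ω'_{j+1}) ∕ blockDownSet (Λ'_{j+1})` for `c < j ≤ k`.
[cite: Balaban1988Convergent, (2.18) p.257 (bookkeeping)] -/
theorem windowKey_twoRunKeyB_eq_of_blockDown (ν : Stage7Numerics) {M : ℕ} (hM : 0 < M) (gB : ℕ → ℝ) (K k c : ℕ) (s' t' : SeqOfRecord F ν M gB (K + 1) (k + 1))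
    (h : ∀ j, c < j → j ≤ k → blockDownSet F K (s'.Ω (j + 1)) = blockDownSet F K (t'.Ω (j + 1)) ∧ blockDownSet F K (s'.Λ (j + 1)) = blockDownSet F K (t'.Λ (j + 1))) :
    windowKey c (twoRunKeyB F ν hM gB K k s') = windowKey c (twoRunKeyB F ν hM gB K k t') := by
  rw [windowKey_twoRunKeyB_eq_iff]
  intro j hj
  by_cases hjk : j ≤ k
  · have h1 : 1 ≤ j := Nat.one_le_of_lt hj
    rw [truncShift_Ω F ν hM gB s' h1 hjk, truncShift_Ω F ν hM gB t' h1 hjk, truncShift_Λ F ν hM gB s' h1 hjk, truncShift_Λ F ν hM gB t' h1 hjk]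
    exact h j hj hjk
  · have hoff : ¬ (1 ≤ j ∧ j ≤ k) := fun h' => hjk h'.2
    rw [(truncShift F ν hM gB s').Ω_off j hoff, (truncShift F ν hM gB t').Ω_off j hoff, (truncShift F ν hM gB s').Λ_off j hoff,
      (truncShift F ν hM gB t').Λ_off j hoff]
    exact ⟨rfl, rfl⟩

end Indices

/-! ## §4  The σ-packed window: one floor per step -/

section Sigma

variable (F : T4Family) {K₀ : ℕ}

/-- **THE σ-PACKED LEVEL WINDOW** on `Σ K, SiteSeqKey F (K₀ + K)` with a floor `c K` per step `K` (the window road's key-reading VALUE: floor `c K = (K₀ + K) − j⋆(K)` for a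
window length `j⋆`). [cite: Balaban1989LargeFieldII, (1.80) p.384 (bookkeeping); Balaban1988Convergent, p.244 (bookkeeping)] -/
def windowKeySigma (c : ℕ → ℕ) (x : Σ K, SiteSeqKey F (K₀ + K)) : Σ K, SiteSeqKey F (K₀ + K) :=
  ⟨x.1, windowKey (c x.1) x.2⟩

/-- The step component is kept. [cite: Balaban1988Convergent, (2.18) p.257 (bookkeeping)] -/
@[simp] theorem windowKeySigma_fst (c : ℕ → ℕ) (x : Σ K, SiteSeqKey F (K₀ + K)) : (windowKeySigma F c x).1 = x.1 := rfl

/-- The key component is the window key at that step's floor. [cite: Balaban1989LargeFieldII, (1.80) p.384 (bookkeeping)] -/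
@[simp] theorem windowKeySigma_snd (c : ℕ → ℕ) (x : Σ K, SiteSeqKey F (K₀ + K)) : (windowKeySigma F c x).2 = windowKey (c x.1) x.2 := rfl

/-- On a packed key `⟨K, y⟩`. [cite: Balaban1989LargeFieldII, (1.80) p.384 (bookkeeping)] -/
theorem windowKeySigma_mk (c : ℕ → ℕ) (K : ℕ) (y : SiteSeqKey F (K₀ + K)) : windowKeySigma F c ⟨K, y⟩ = ⟨K, windowKey (c K) y⟩ := rfl

/-- **FLOOR `0` AT EVERY STEP IS THE IDENTITY** (the record's pinned key). [cite: Balaban1988Convergent, (2.18) p.257 (bookkeeping)] -/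
theorem windowKeySigma_zero (x : Σ K, SiteSeqKey F (K₀ + K)) : windowKeySigma F (fun _ => 0) x = x := by
  obtain ⟨K, y⟩ := x
  rw [windowKeySigma_mk, windowKey_zero]

/-- The σ-packed windows compose floorwise to the higher floor. [cite: Balaban1989LargeFieldII, (1.80) p.384 (bookkeeping)] -/
theorem windowKeySigma_windowKeySigma (c c' : ℕ → ℕ) (x : Σ K, SiteSeqKey F (K₀ + K)) :
    windowKeySigma F c' (windowKeySigma F c x) = windowKeySigma F (fun K => max (c K) (c' K)) x := by
  obtain ⟨K, y⟩ := x
  rw [windowKeySigma_mk, windowKeySigma_mk, windowKeySigma_mk, windowKey_windowKey]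

/-- The σ-packed window is idempotent. [cite: Balaban1989LargeFieldII, (1.80) p.384 (bookkeeping)] -/
theorem windowKeySigma_idem (c : ℕ → ℕ) (x : Σ K, SiteSeqKey F (K₀ + K)) : windowKeySigma F c (windowKeySigma F c x) = windowKeySigma F c x := by
  rw [windowKeySigma_windowKeySigma]
  simp only [max_self]

/-- Persistence on the σ-packed window key: old regions strictly between the floor and the cut. [cite: Balaban1989LargeFieldII, (1.80) p.384 (bookkeeping)] -/
theorem keyOldLargeField_windowKeySigma_iff (c jcut : ℕ → ℕ) (x : Σ K, SiteSeqKey F (K₀ + K)) :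
    KeyOldLargeField (jcut (windowKeySigma F c x).1) (windowKeySigma F c x).2 ↔ ∃ j, c x.1 < j ∧ j ≤ jcut x.1 ∧ x.2.2 j ≠ Set.univ :=
  keyOldLargeField_windowKey_iff (jcut x.1) (c x.1) x.2

/-- ★ **A POLICY AT OR BELOW THE FLOOR BOOKS NOTHING**: if `jcut K ≤ c K` at every step, the persistence class of ANY windowed class set is EMPTY — at the window key the
level-cut bad class of `Node00/TwoRunSitePersistence` sees only cuts above the floor. [cite: Balaban1989LargeFieldII, (1.80) p.384 (bookkeeping)] -/
theorem badKeysSigma_image_windowKeySigma_eq_empty [DecidableEq (Σ K, SiteSeqKey F (K₀ + K))] (T : Finset (Σ K, SiteSeqKey F (K₀ + K))) {c jcut : ℕ → ℕ}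
    (h : ∀ K, jcut K ≤ c K) : badKeysSigma F (T.image (windowKeySigma F c)) jcut = ∅ := by
  refine Finset.eq_empty_of_forall_notMem fun x hx => ?_
  obtain ⟨hxT, hbad⟩ := (mem_badKeysSigma_iff F _ jcut x).1 hx
  obtain ⟨y, -, rfl⟩ := Finset.mem_image.mp hxT
  exact not_keyOldLargeField_windowKey (h y.1) y.2 hbad

/-- A bad window key comes from a bad key: the persistence class of a windowed class set lies in the window image of the persistence class.
[cite: Balaban1989LargeFieldII, (1.80) p.384 (bookkeeping)] -/
theorem badKeysSigma_image_windowKeySigma_subset [DecidableEq (Σ K, SiteSeqKey F (K₀ + K))] (T : Finset (Σ K, SiteSeqKey F (K₀ + K))) (c jcut : ℕ → ℕ) :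
    badKeysSigma F (T.image (windowKeySigma F c)) jcut ⊆ (badKeysSigma F T jcut).image (windowKeySigma F c) := by
  intro x hx
  obtain ⟨hxT, hbad⟩ := (mem_badKeysSigma_iff F _ jcut x).1 hx
  obtain ⟨y, hy, rfl⟩ := Finset.mem_image.mp hxT
  exact Finset.mem_image.mpr ⟨y, (mem_badKeysSigma_iff F T jcut y).2 ⟨hy, keyOldLargeField_of_windowKey hbad⟩, rfl⟩

end Sigma

/-! ## §5  The volume of the large-field region at a level (v1.2: the object a FLOOR-VOLUME bad reading books with) -/

section Volume

variable {α : Type*}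

/-- **THE LARGE-FIELD VOLUME OF A KEY AT LEVEL `j`**: the number of finest sites in the large-field region `Z_j = Λ_jᶜ = (x.2 j)ᶜ` (`Nat.card`; on the finite
torus a genuine count). [cite: Balaban1989LargeFieldII, (1.79) p.383 (bookkeeping); Balaban1988Convergent, (2.18) p.257 (bookkeeping)] -/
def largeFieldVolume (j : ℕ) (x : (ℕ → Set α) × (ℕ → Set α)) : ℕ :=
  Nat.card ↥((x.2 j)ᶜ)

/-- Unfolding. [cite: Balaban1988Convergent, (2.18) p.257 (bookkeeping)] -/
theorem largeFieldVolume_eq (j : ℕ) (x : (ℕ → Set α) × (ℕ → Set α)) : largeFieldVolume j x = Nat.card ↥((x.2 j)ᶜ) := rfl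

/-- On a finite lattice the large-field volume VANISHES iff there is NO large-field region at that level (`Λ_j = T_η`).
[cite: Balaban1989LargeFieldI, (0.2) p.176 (bookkeeping)] -/
theorem largeFieldVolume_eq_zero_iff [Finite α] (j : ℕ) (x : (ℕ → Set α) × (ℕ → Set α)) : largeFieldVolume j x = 0 ↔ x.2 j = Set.univ := by
  rw [largeFieldVolume_eq, Nat.card_eq_zero, or_iff_left (not_infinite_iff_finite.mpr inferInstance), Set.isEmpty_coe_sort, Set.compl_empty_iff]

/-- … and is POSITIVE iff the key carries a large-field region at that level. [cite: Balaban1989LargeFieldII, (1.79) p.383 (bookkeeping)] -/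
theorem largeFieldVolume_pos_iff [Finite α] (j : ℕ) (x : (ℕ → Set α) × (ℕ → Set α)) : 0 < largeFieldVolume j x ↔ x.2 j ≠ Set.univ := by
  rw [pos_iff_ne_zero, Ne, largeFieldVolume_eq_zero_iff]

/-- The persistence predicate through volumes: an old large-field region at a level `≤ jcut` iff a positive large-field volume at some level `1 ≤ j ≤ jcut`.
[cite: Balaban1989LargeFieldII, (1.80) p.384 (bookkeeping)] -/
theorem keyOldLargeField_iff_exists_largeFieldVolume_pos [Finite α] (jcut : ℕ) (x : (ℕ → Set α) × (ℕ → Set α)) :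
    KeyOldLargeField jcut x ↔ ∃ j, 1 ≤ j ∧ j ≤ jcut ∧ 0 < largeFieldVolume j x := by
  simp only [KeyOldLargeField, largeFieldVolume_pos_iff]

/-- ABOVE THE FLOOR the window key has the key's large-field volumes. [cite: Balaban1989LargeFieldII, (1.80) p.384 (bookkeeping)] -/
theorem largeFieldVolume_windowKey_of_lt (c : ℕ) (x : (ℕ → Set α) × (ℕ → Set α)) {j : ℕ} (hj : c < j) :
    largeFieldVolume j (windowKey c x) = largeFieldVolume j x := by
  rw [largeFieldVolume_eq, largeFieldVolume_eq, windowKey_snd_of_lt c x hj]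

/-- AT OR BELOW THE FLOOR the window key has NO large-field volume. [cite: Balaban1989LargeFieldII, (1.80) p.384 (bookkeeping)] -/
theorem largeFieldVolume_windowKey_of_le (c : ℕ) (x : (ℕ → Set α) × (ℕ → Set α)) {j : ℕ} (h1 : 1 ≤ j) (hj : j ≤ c) :
    largeFieldVolume j (windowKey c x) = 0 := by
  rw [largeFieldVolume_eq, windowKey_snd_of_le c x h1 hj, Set.compl_univ]
  exact Nat.card_of_isEmpty

/-- At the level just above the floor, «volume ≥ 1» on the window key is «a large-field region at the floor level» on the key — the level cut at `c + 1` read on the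
floor-`c` window (`keyOldLargeField_windowKey_iff`). [cite: Balaban1989LargeFieldII, (1.80) p.384 (bookkeeping)] -/
theorem one_le_largeFieldVolume_windowKey_succ_iff [Finite α] (c : ℕ) (x : (ℕ → Set α) × (ℕ → Set α)) :
    1 ≤ largeFieldVolume (c + 1) (windowKey c x) ↔ KeyOldLargeField (c + 1) (windowKey c x) := by
  rw [Nat.one_le_iff_ne_zero, ← pos_iff_ne_zero, largeFieldVolume_windowKey_of_lt c x (Nat.lt_succ_self c), largeFieldVolume_pos_iff,
    keyOldLargeField_windowKey_iff]
  constructor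
  · exact fun h => ⟨c + 1, Nat.lt_succ_self c, le_rfl, h⟩
  · rintro ⟨j, hcj, hj, hne⟩
    obtain rfl : j = c + 1 := le_antisymm hj hcj
    exact hne

/-- The σ-packed window keeps the volumes above its floor. [cite: Balaban1989LargeFieldII, (1.80) p.384 (bookkeeping)] -/
theorem largeFieldVolume_windowKeySigma_of_lt (F : T4Family) {K₀ : ℕ} (c : ℕ → ℕ) (x : Σ K, SiteSeqKey F (K₀ + K)) {j : ℕ} (hj : c x.1 < j) :
    largeFieldVolume j (windowKeySigma F c x).2 = largeFieldVolume j x.2 :=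
  largeFieldVolume_windowKey_of_lt (c x.1) x.2 hj

end Volume

end Literature.MathematicalPhysics.QuantumFieldTheory.Balaban1983to89.Node00

end
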